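import Literature.Geometry.Lorentzian.KerrFiniteSpeedOfPropagation
import Literature.Barriers.FinalStateConjecture.ExtremalHorizonShellEnergyDecay
import HarnessLib

/-!
# Barrier catalogue `FinalStateConjecture`: finite speed of propagation for Aretakis's class of
# waves on extremal Kerr (far region): localised data stay localised on the later leaves
# (`Literature/Barriers/FinalStateConjecture/`, D-0021, D-0014; family `gr`)

Written from the proving seat of `Literature.Barriers.FinalStateConjecture.Aretakis2012_pointwiseDecay`
(Aretakis, JFA 263 (2012), Thm. 5). The class of that named fact — and of the reductions
`Aretakis2012_pointwiseDecay_of_uniformBoundedness_of_integratedDecay`,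
`Kerr.degTEnergy_antitone_and_horizonFlux_le`, … of this catalogue — consists of functions `Φ`
which are `C^∞` on an open set `U₀ ⊇ {r ≥ M, t* ≥ 0}` of the extremal Kerr–Schild chart, solve
`□_{g_{M,M}} Φ = 0` there, and have data vanishing on the initial leaf outside a ball,
`(Φ, dΦ)(0, x⃗) = 0` for `‖x⃗‖ > ρ`. Every energy identity for such waves on a region reaching out to
large `r` needs the wave to vanish there at later times: the source (Aretakis 2012, §2.3, "the
Cauchy problem", with regular compactly supported data) uses this through the domain of dependence
property. The tree's `kerr_finite_speed_of_propagation` (`KerrWaveEnergy.lean`, proved in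
`KerrFiniteSpeedOfPropagation.lean`) covers subextremal exteriors and globally defined solutions;
**this file proves the far-region statement needed for the extremal class**:

* `Kerr.eq_zero_of_far`: `Φ(x) = 0` and `dΦ(x) = 0` whenever `x⁰ ≥ 0` and
  `‖x⃗‖ > max(ρ, 2M) + 1 + x⁰`;
* `Kerr.fderiv_shellPoint_eq_zero_of_far`: hence `dΦ = 0` at the shell points `p(t, r₂, θ, φ)`,
  `0 ≤ t ≤ T`, as soon as `r₂ > max(ρ, 2M) + 1 + T` (`‖Y_M(r, θ, φ)‖ ≥ r`) — the "no flux through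
  the outer cylinder" hypothesis of the `T`-energy identities.

**Proof.** Hawking–Ellis's conservation theorem in the weighted form
`KerrSchild.Background.fderiv_eq_zero_of_weight` (`KerrSchildLocalEnergy.lean`; energy method for
the `dt*`-current, dominant energy condition) on the surgered Kerr–Schild background
`Kerr.surgeryBackground M M r₀`, which is the Kerr metric on the chart
(`Kerr.dalembertian_eq_waveOperator`, `Kerr.surgeryBackground_inverseMetric_eventuallyEq`), with the
weight `W = χ(2t*/η + 2) χ(R − t* − (ε₁² + ‖y − y₀‖²)^{1/2})` — the truncated backward coordinate
cone of `x = (t₀, y₀)`, `t₀ < R < ‖y₀‖ − max(ρ, 2M) − 1`, whose conormal `dt* + n⃗·dy⃗`, `|n⃗| < 1`,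
is past causal on every Kerr–Schild background (`coneArg_covector`, `coneCovector_causal`,
`sum_mul_normalCurrent_nonneg`, combined by `sum_fderiv_smoothTransition_mul_le` of
`KerrDependenceWeights.lean`). All points of the fattened cone have `‖y‖ > 2M`, hence `r > M`
(`lt_radius_of_two_mul_lt_spatialNorm`), so its part with `t* ≥ 0` lies in `U₀`; the margin `η > 0`
below `t* = 0` is chosen by compactness (`IsCompact.exists_thickening_subset_open`) so that the whole
support of `W` does. Then `dΦ = 0` along `[0, t₀] × {y₀}` and `Φ(x) = Φ(0, y₀) = 0`. No horizon
layer is needed (unlike the subextremal exterior version), the cone staying in `{r > M}`.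
Everything is proved; no named facts.

## References

* C. Bär, N. Ginoux, F. Pfäffle, *Wave equations on Lorentzian manifolds and quantization*, EMS
  2007 (arXiv:0806.1036): Ch. 3, Sect. 2, Thm. 2.9 of the arXiv version = Thm. 3.2.11 of the book
  (`supp u ⊂ J^M(K)`) (key `BarGinouxPfaffle2007`).
* S. W. Hawking, G. F. R. Ellis, *The large scale structure of space-time*, CUP 1973, §4.3,
  Lemma 4.3.1 and the conservation theorem (key `HawkingEllis1973CUP`).
* S. Aretakis, J. Funct. Anal. 263 (2012) 2770–2831 (arXiv:1110.2006), §2.3 (the Cauchy problem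
  for the class) (key `Aretakis2012`).
-/

noncomputable section

open Set Filter Metric
open scoped Topology ContDiff Manifold

namespace Literature.Barriers.FinalStateConjecture.Kerr

open Literature.Geometry.Lorentzian

/-! ### Elementary geometry of the chart: time shifts and the radius far out -/

/-- The distance between two points on the same `t*`-line is the time difference. [folklore] -/
theorem dist_ofTimeSpace_ofTimeSpace (t s : ℝ) (y : E3) :
    dist (E4.ofTimeSpace t y) (E4.ofTimeSpace s y) = |t - s| := by
  rw [dist_eq_norm, E4.ofTimeSpace_eq_smul_add' t y, E4.ofTimeSpace_eq_smul_add' s y,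
    add_sub_add_right_eq_sub, ← sub_smul, norm_smul, Real.norm_eq_abs]
  have : ‖E4.basisVector 0‖ = 1 := by simp [E4.basisVector]
  rw [this, mul_one]

/-- **Far out the Kerr–Schild radius exceeds `M`**: `‖x⃗‖ > 2M ≥ 0` gives `r > M` for `a = M`
(`r² ≥ ‖x⃗‖² − a²`). [folklore] -/
theorem lt_radius_of_two_mul_lt_spatialNorm {M : ℝ} (hM : 0 ≤ M) {x : E4}
    (hx : 2 * M < E4.spatialNorm x) : M < Kerr.radius M x := by
  have h1 := Kerr.spatialNorm_sq_sub_sq_le_radius_sq M x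
  have h0 := Kerr.radius_nonneg M x
  nlinarith [E4.spatialNorm_nonneg x]

section FiniteSpeed

variable [Kerr.Facts] [Kerr.SliceFacts] {M r₀ : ℝ} {U₀ : Set (Kerr.region M r₀)} {Φ : E4 → ℝ}

/-- **Finite speed of propagation for Aretakis's class in the far region of the extremal
Kerr–Schild chart.** Let `Φ` be `C^∞` at the points of an open set `U₀ ⊇ {r ≥ M, t* ≥ 0}` of the
chart of extremal Kerr (`a = M > 0`), solve `□_{g_{M,M}} Φ = 0` there, and have data vanishing at
the points of the initial leaf `{t* = 0}` in `U₀` with `‖x⃗‖ > ρ`. Then `Φ(x) = 0` and `dΦ(x) = 0`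
at every point `x` with `x⁰ ≥ 0` and `‖x⃗‖ > max(ρ, 2M) + 1 + x⁰`: nothing propagates faster than
the coordinate speed of light in the region `{‖x⃗‖ > 2M}` (which lies outside the horizon,
`lt_radius_of_two_mul_lt_spatialNorm`). Proof: Hawking–Ellis's conservation theorem in the
weighted form `KerrSchild.Background.fderiv_eq_zero_of_weight` (`KerrSchildLocalEnergy.lean`) on the
surgered background `Kerr.surgeryBackground M M r₀` (equal to Kerr on the chart), with the weight
`W = χ(2t*/η + 2) χ(R − t* − (ε₁² + ‖y − y₀‖²)^{1/2})` — the truncated backward coordinate cone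
of `x = (t₀, y₀)`, whose conormal `dt* + n⃗·dy⃗`, `|n⃗| < 1`, is past causal for every Kerr–Schild
background (`coneArg_covector`, `coneCovector_causal`, dominant energy condition
`sum_mul_normalCurrent_nonneg`); the small `η > 0` is chosen by compactness
(`IsCompact.exists_thickening_subset_open`) so that the part `−η ≤ t* ≤ 0` of the truncated cone
still lies in the open set `U₀`. This is the far-region case of Bär–Ginoux–Pfäffle 2007,
Thm. 3.2.11 (`supp u ⊂ J(supp data)`) for the class, cf. the subextremal exterior version
`kerr_finite_speed_of_propagation_holds`. [cite: BarGinouxPfaffle2007, Ch. 3 Sect. 2 (Thm. 2.9 of the arXiv version)] -/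
theorem eq_zero_of_far (hM : 0 < M) (hr₀ : r₀ ∈ Set.Ioo 0 M) (hU₀ : IsOpen U₀)
    (hKU : {x : Kerr.region M r₀ | Kerr.rPlus M M ≤ Kerr.radius M (x : E4) ∧ 0 ≤ (x : E4) 0} ⊆ U₀)
    (hΦ : ∀ x ∈ U₀, ContDiffAt ℝ ∞ Φ x)
    (hsol : ∀ x ∈ U₀, (Kerr.smoothMetric M M r₀).toPseudoRiemannianMetric.dalembertian
      (fun y : Kerr.region M r₀ ↦ Φ y) x = 0)
    {ρ : ℝ} (hloc : ∀ x ∈ U₀, (x : E4) 0 = 0 → ρ < E4.spatialNorm (x : E4) → Φ x = 0 ∧ fderiv ℝ Φ x = 0)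
    {z : E4} (hz0 : 0 ≤ z 0) (hzfar : max ρ (2 * M) + 1 + z 0 < E4.spatialNorm z) :
    Φ z = 0 ∧ fderiv ℝ Φ z = 0 := by
  classical
  obtain ⟨hr₀pos, hr₀M⟩ := hr₀
  set ρ₁ : ℝ := max ρ (2 * M) with hρ₁
  have hρρ₁ : ρ ≤ ρ₁ := le_max_left _ _
  have h2Mρ₁ : 2 * M ≤ ρ₁ := le_max_right _ _
  -- ### the open set of `E4` over `U₀`, membership from the radius
  set U : Set E4 := Subtype.val '' U₀ with hUdef
  have hU : IsOpen U := (Kerr.region M r₀).isOpen.isOpenMap_subtype_val U₀ hU₀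
  have hUU₀ : ∀ w ∈ U, ∃ hw : w ∈ Kerr.region M r₀, (⟨w, hw⟩ : Kerr.region M r₀) ∈ U₀ := by
    rintro _ ⟨x, hx, rfl⟩; exact ⟨x.2, hx⟩
  have hreg : ∀ w : E4, M < Kerr.radius M w → w ∈ Kerr.region M r₀ := fun w hw ↦ by
    rw [Kerr.mem_region]; exact max_lt (by linarith) (by linarith)
  have hmemU : ∀ w : E4, M < Kerr.radius M w → 0 ≤ w 0 → w ∈ U := by
    intro w hw hw0
    refine ⟨⟨w, hreg w hw⟩, hKU ⟨?_, hw0⟩, rfl⟩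
    show Kerr.rPlus M M ≤ Kerr.radius M w
    rw [Kerr.rPlus_self]; exact hw.le
  have hfarU : ∀ w : E4, 2 * M < E4.spatialNorm w → 0 ≤ w 0 → w ∈ U := fun w hw hw0 ↦
    hmemU w (lt_radius_of_two_mul_lt_spatialNorm hM.le hw) hw0
  have hΦU : ∀ w ∈ U, ContDiffAt ℝ ∞ Φ w := by
    rintro _ ⟨x, hx, rfl⟩; exact hΦ x hx
  have hΦ2 : ∀ w ∈ U, ContDiffAt ℝ 2 Φ w := fun w hw ↦
    (hΦU w hw).of_le (WithTop.coe_le_coe.mpr le_top)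
  -- ### the background and the equation in divergence form on `U`
  set B := Kerr.surgeryBackground M M r₀ hM.le hr₀pos with hB
  have hwave : ∀ w ∈ U, KerrSchild.waveOperator B.inverseMetric Φ w = 0 := by
    intro w hw
    obtain ⟨hwr, hwU⟩ := hUU₀ w hw
    have h1 := Kerr.dalembertian_eq_waveOperator M M r₀ (ψ := fun y : Kerr.region M r₀ ↦ Φ y)
      (Φ := Φ) (fun _ ↦ rfl) ⟨w, hwr⟩ (hΦ2 w hw)
    rw [KerrSchild.waveOperator_congr_of_eventuallyEq
      (Kerr.surgeryBackground_inverseMetric_eventuallyEq M M hM.le hr₀pos ⟨w, hwr⟩) Φ] at h1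
    rw [← h1]
    exact hsol _ hwU
  -- ### the point `z = (t₀, y₀)` and the constants
  set t₀ : ℝ := z 0 with ht₀
  set y₀ : E3 := E4.spatial z with hy₀
  have hzeq : z = E4.ofTimeSpace t₀ y₀ := (E4.ofTimeSpace_time_spatial _).symm
  have hsn : E4.spatialNorm z = ‖y₀‖ := rfl
  rw [hsn] at hzfar
  set R : ℝ := (t₀ + (‖y₀‖ - ρ₁ - 1)) / 2 with hR
  have hR1 : t₀ < R := by rw [hR]; linarith
  have hR2 : R < ‖y₀‖ - ρ₁ - 1 := by rw [hR]; linarith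
  set ε₁ : ℝ := (R - t₀) / 2 with hε₁
  have hε₁0 : 0 < ε₁ := by rw [hε₁]; linarith
  have hε₁R : ε₁ < R - t₀ := by rw [hε₁]; linarith
  -- points of the (fattened) cone are far out
  have hfar_of : ∀ w : E4, ‖E4.spatial w - y₀‖ ≤ R + 1 → ρ₁ < E4.spatialNorm w := by
    intro w hw
    have hy : ‖y₀‖ - ‖E4.spatial w‖ ≤ ‖E4.spatial w - y₀‖ := by
      rw [← norm_sub_rev]; exact norm_sub_norm_le _ _
    change ρ₁ < ‖E4.spatial w‖
    linarith
  -- ### the compact initial slab piece and the time margin `η`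
  set S : Set E4 := {w : E4 | w 0 = 0} ∩ {w : E4 | ‖E4.spatial w - y₀‖ ≤ R + 1} with hSdef
  have hSc : IsCompact S := by
    have hclosed : IsClosed S :=
      (isClosed_eq (PiLp.continuous_apply 2 _ 0) continuous_const).inter
        (isClosed_le (continuous_norm.comp (E4.spatial.continuous.sub continuous_const))
          continuous_const)
    refine Metric.isCompact_of_isClosed_isBounded hclosed ?_
    refine isBounded_iff_forall_norm_le.mpr ⟨R + 1 + ‖y₀‖, fun w hw ↦ ?_⟩
    obtain ⟨h0, h1⟩ := hw
    have h1' : ‖E4.spatial w - y₀‖ ≤ R + 1 := h1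
    have hs : E4.spatialNorm w ≤ R + 1 + ‖y₀‖ := by
      have : ‖E4.spatial w‖ ≤ ‖E4.spatial w - y₀‖ + ‖y₀‖ := by
        calc ‖E4.spatial w‖ = ‖(E4.spatial w - y₀) + y₀‖ := by rw [sub_add_cancel]
          _ ≤ ‖E4.spatial w - y₀‖ + ‖y₀‖ := norm_add_le _ _
      change ‖E4.spatial w‖ ≤ _
      linarith
    have hsq : ‖w‖ ^ 2 = w 0 ^ 2 + E4.spatialNorm w ^ 2 := by
      rw [EuclideanSpace.norm_sq_eq, Fin.sum_univ_four, E4.spatialNorm_sq]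
      simp only [Real.norm_eq_abs, sq_abs]
      ring
    have h0' : w 0 = 0 := h0
    rw [h0', zero_pow two_ne_zero, zero_add] at hsq
    have : ‖w‖ = E4.spatialNorm w := by
      have hn := norm_nonneg w
      have hs0 := E4.spatialNorm_nonneg w
      nlinarith [hsq]
    linarith
  have hSU : S ⊆ U := fun w hw ↦ hfarU w (lt_of_le_of_lt h2Mρ₁ (hfar_of w hw.2)) (le_of_eq hw.1.symm)
  obtain ⟨δ, hδ, hthick⟩ := hSc.exists_thickening_subset_open hU hSU
  set η : ℝ := min (δ / 2) (1 / 2) with hηdef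
  have hη : 0 < η := lt_min (by positivity) (by norm_num)
  have hηδ : η < δ := (min_le_left _ _).trans_lt (by linarith)
  have hη1 : η ≤ 1 / 2 := min_le_right _ _
  -- points slightly below the slab piece are in `U`
  have hpastU : ∀ w : E4, -η ≤ w 0 → w 0 ≤ 0 → ‖E4.spatial w - y₀‖ ≤ R + 1 → w ∈ U := by
    intro w hw1 hw2 hw3
    refine hthick ?_
    rw [Metric.mem_thickening_iff]
    refine ⟨E4.ofTimeSpace 0 (E4.spatial w), ⟨by simp, by simpa using hw3⟩, ?_⟩
    have hdist : dist w (E4.ofTimeSpace 0 (E4.spatial w)) = |w 0| := by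
      have h := dist_ofTimeSpace_ofTimeSpace (E4.time w) 0 (E4.spatial w)
      rw [E4.ofTimeSpace_time_spatial, sub_zero] at h
      exact h
    rw [hdist, abs_of_nonpos hw2]
    linarith
  -- ### the weight
  set q₁ : E4 → ℝ := fun w ↦ R - w 0 - √(ε₁ ^ 2 + ‖E4.spatial w - y₀‖ ^ 2) with hq₁
  set W : E4 → ℝ := fun w ↦ Real.smoothTransition (2 * w 0 / η + 2) * Real.smoothTransition (q₁ w)
    with hW
  have htimeC : ContDiff ℝ 1 fun w : E4 ↦ Real.smoothTransition (2 * w 0 / η + 2) := by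
    refine Real.smoothTransition.contDiff.comp ?_
    exact (((contDiff_const.mul (E4.dx 0).contDiff).div_const η).add contDiff_const)
  have hW1 : ContDiff ℝ 1 W :=
    htimeC.mul (Real.smoothTransition.contDiff.comp (contDiff_coneArg hε₁0.ne' R y₀))
  have hW0 : ∀ w, 0 ≤ W w := fun w ↦
    mul_nonneg (Real.smoothTransition.nonneg _) (Real.smoothTransition.nonneg _)
  have hWsupp : ∀ w, W w ≠ 0 → -η < w 0 ∧ ‖E4.spatial w - y₀‖ < R - w 0 := by
    intro w hw
    obtain ⟨h1, h2⟩ := mul_ne_zero_iff.mp hw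
    constructor
    · have hq : 0 < 2 * w 0 / η + 2 := by
        by_contra hle
        exact h1 (Real.smoothTransition.zero_of_nonpos (not_lt.mp hle))
      have : 0 < 2 * (w 0 + η) / η := by
        have : 2 * w 0 / η + 2 = 2 * (w 0 + η) / η := by field_simp
        linarith
      have := (div_pos_iff_of_pos_right hη).mp this
      linarith
    · have hq : 0 < q₁ w := by
        by_contra hle
        exact h2 (Real.smoothTransition.zero_of_nonpos (not_lt.mp hle))
      have := norm_le_sqrt_sq_add_norm_sq ε₁ (E4.spatial w - y₀)
      simp only [hq₁] at hq
      linarith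
  -- near points with `t* ≥ 0` the time factor is `1`
  have hWev : ∀ w : E4, 0 ≤ w 0 → W =ᶠ[𝓝 w]
      fun w' ↦ Real.smoothTransition (q₁ w') * Real.smoothTransition ((fun _ : E4 ↦ (2 : ℝ)) w') := by
    intro w hw0
    have hopen : IsOpen {w' : E4 | -(η / 2) < w' 0} := isOpen_lt continuous_const (PiLp.continuous_apply 2 _ 0)
    filter_upwards [hopen.mem_nhds (show -(η / 2) < w 0 by linarith)] with w' hw'
    have h1 : Real.smoothTransition (2 * w' 0 / η + 2) = 1 := by
      refine Real.smoothTransition.one_of_one_le ?_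
      have hw'' : -(η / 2) < w' 0 := hw'
      have : -1 < 2 * w' 0 / η := by
        rw [lt_div_iff₀ hη]; linarith
      linarith
    have h2 : Real.smoothTransition (2 : ℝ) = 1 := Real.smoothTransition.one_of_one_le one_le_two
    simp only [hW, h1, h2, one_mul, mul_one]
  -- ### the compact set `K ⊇ supp W`
  set K : Set E4 := {w : E4 | w 0 ∈ Set.Icc (-η) R} ∩ {w : E4 | ‖E4.spatial w - y₀‖ ≤ R + 1} with hK
  have hKclosed : IsClosed K :=
    (isClosed_Icc.preimage (E4.dx 0).continuous).inter
      (isClosed_le (continuous_norm.comp (E4.spatial.continuous.sub continuous_const)) continuous_const)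
  have hKbdd : Bornology.IsBounded K := by
    refine isBounded_iff_forall_norm_le.mpr ⟨(1 + |R|) + (R + 1 + ‖y₀‖), fun w hw ↦ ?_⟩
    obtain ⟨⟨h1, h2⟩, h3⟩ := hw
    have ht : |w 0| ≤ 1 + |R| := by
      rw [abs_le]
      constructor
      · linarith [abs_nonneg R]
      · linarith [le_abs_self R]
    have hs : E4.spatialNorm w ≤ R + 1 + ‖y₀‖ := by
      have : ‖E4.spatial w‖ ≤ ‖E4.spatial w - y₀‖ + ‖y₀‖ := by
        calc ‖E4.spatial w‖ = ‖(E4.spatial w - y₀) + y₀‖ := by rw [sub_add_cancel]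
          _ ≤ ‖E4.spatial w - y₀‖ + ‖y₀‖ := norm_add_le _ _
      have h3' : ‖E4.spatial w - y₀‖ ≤ R + 1 := h3
      change ‖E4.spatial w‖ ≤ _
      exact this.trans (by linarith [h3'])
    have hnorm : ‖w‖ ≤ |w 0| + E4.spatialNorm w := by
      have hs0 : 0 ≤ E4.spatialNorm w := E4.spatialNorm_nonneg w
      have hsq : ‖w‖ ^ 2 = w 0 ^ 2 + E4.spatialNorm w ^ 2 := by
        rw [EuclideanSpace.norm_sq_eq, Fin.sum_univ_four, E4.spatialNorm_sq]
        simp only [Real.norm_eq_abs, sq_abs]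
        ring
      have h2 : ‖w‖ ^ 2 ≤ (|w 0| + E4.spatialNorm w) ^ 2 := by
        rw [hsq]
        nlinarith [abs_nonneg (w 0), sq_abs (w 0)]
      exact (pow_le_pow_iff_left₀ (norm_nonneg w) (by positivity) two_ne_zero).mp h2
    linarith
  have hKc : IsCompact K := Metric.isCompact_of_isClosed_isBounded hKclosed hKbdd
  have hKU' : K ⊆ U := by
    intro w hw
    obtain ⟨⟨h1, _⟩, h3⟩ := hw
    by_cases hw0 : 0 ≤ w 0
    · exact hfarU w (lt_of_le_of_lt h2Mρ₁ (hfar_of w h3)) hw0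
    · exact hpastU w h1 (le_of_lt (not_le.mp hw0)) h3
  have hWK : ∀ w, W w ≠ 0 → w ∈ K := by
    intro w hw
    obtain ⟨h1, h2⟩ := hWsupp w hw
    have hn : 0 ≤ ‖E4.spatial w - y₀‖ := norm_nonneg _
    exact ⟨⟨h1.le, by linarith⟩, by show ‖E4.spatial w - y₀‖ ≤ R + 1; linarith⟩
  -- ### the hypotheses of the conservation theorem
  have hsolK : ∀ w ∈ K, KerrSchild.waveOperator B.inverseMetric Φ w = 0 := fun w hw ↦ hwave w (hKU' hw)
  have hflux : ∀ w ∈ K, 0 ≤ w 0 → w 0 ≤ t₀ →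
      ∑ μ, fderiv ℝ W w (E4.basisVector μ) * KerrSchild.normalCurrent B.inverseMetric Φ w μ ≤ 0 := by
    intro w _ hw0 _
    have hq₁d : DifferentiableAt ℝ q₁ w := (coneArg_hasFDerivAt hε₁0.ne' R y₀ w).differentiableAt
    refine sum_fderiv_smoothTransition_mul_le _ (hWev w hw0) hq₁d (differentiableAt_const _) ?_
      (Or.inl (deriv_smoothTransition_eq_zero_of_one_lt one_lt_two))
    obtain ⟨hν0, hn⟩ := coneArg_covector hε₁0.ne' R y₀ w
    have hc := B.coneCovector_causal w (fun μ ↦ -fderiv ℝ q₁ w (E4.basisVector μ)) hν0 hn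
    have hpos := B.sum_mul_normalCurrent_nonneg Φ w (fun μ ↦ -fderiv ℝ q₁ w (E4.basisVector μ))
      hc.1 hc.2
    have hsum : ∑ μ, fderiv ℝ q₁ w (E4.basisVector μ) * KerrSchild.normalCurrent B.inverseMetric Φ w μ =
        -∑ μ, -fderiv ℝ q₁ w (E4.basisVector μ) * KerrSchild.normalCurrent B.inverseMetric Φ w μ := by
      rw [← Finset.sum_neg_distrib]
      exact Finset.sum_congr rfl fun μ _ ↦ by ring
    rw [hsum]
    linarith
  have hdataW : ∀ w, w 0 = 0 → W w ≠ 0 → fderiv ℝ Φ w = 0 := by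
    intro w hw0 hw
    obtain ⟨-, h2⟩ := hWsupp w hw
    rw [hw0, sub_zero] at h2
    have hfar : ρ₁ + 1 < E4.spatialNorm w := by
      have hy : ‖y₀‖ - ‖E4.spatial w‖ ≤ ‖E4.spatial w - y₀‖ := by
        rw [← norm_sub_rev]; exact norm_sub_norm_le _ _
      change ρ₁ + 1 < ‖E4.spatial w‖
      linarith
    have hwU : w ∈ U := hfarU w (by linarith) (le_of_eq hw0.symm)
    obtain ⟨hwr, hwU₀⟩ := hUU₀ w hwU
    exact (hloc ⟨w, hwr⟩ hwU₀ hw0 (by show ρ < E4.spatialNorm w; linarith)).2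
  -- ### `dΦ = 0` along the segment `[0, t₀] × {y₀}`
  have hseg : ∀ t ∈ Set.Icc (0 : ℝ) t₀, fderiv ℝ Φ (E4.ofTimeSpace t y₀) = 0 := by
    intro t ht
    have hWt : W (E4.ofTimeSpace t y₀) ≠ 0 := by
      simp only [hW, hq₁, E4.ofTimeSpace_apply_zero, E4.spatial_ofTimeSpace, sub_self, norm_zero]
      refine mul_ne_zero (Real.smoothTransition.pos_of_pos ?_).ne' (Real.smoothTransition.pos_of_pos ?_).ne'
      · have : 0 ≤ 2 * t / η := div_nonneg (by linarith [ht.1]) hη.le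
        linarith
      · have : √(ε₁ ^ 2 + (0 : ℝ) ^ 2) = ε₁ := by
          rw [zero_pow two_ne_zero, add_zero, Real.sqrt_sq hε₁0.le]
        rw [this]
        linarith [ht.2]
    exact B.fderiv_eq_zero_of_weight hKc hKU' hΦ2 hW1 hW0 hWK hsolK hflux hdataW
      (x := E4.ofTimeSpace t y₀) (by simpa using ht.1) (by simpa using ht.2) hWt
  -- ### conclusion
  have hy₀ρ : ρ₁ + 1 < ‖y₀‖ := by linarith
  have hsegU : ∀ t : ℝ, 0 ≤ t → E4.ofTimeSpace t y₀ ∈ U := fun t ht ↦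
    hfarU _ (by rw [E4.spatialNorm_ofTimeSpace]; linarith) (by simpa using ht)
  have hdata0 : Φ (E4.ofTimeSpace 0 y₀) = 0 := by
    obtain ⟨hwr, hwU₀⟩ := hUU₀ _ (hsegU 0 le_rfl)
    exact (hloc ⟨_, hwr⟩ hwU₀ (by simp) (by
      show ρ < E4.spatialNorm (E4.ofTimeSpace 0 y₀)
      rw [E4.spatialNorm_ofTimeSpace]; linarith)).1
  have hΦd : ∀ t : ℝ, 0 ≤ t → DifferentiableAt ℝ Φ (E4.ofTimeSpace t y₀) := fun t ht ↦
    (hΦU _ (hsegU t ht)).differentiableAt (by simp)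
  refine ⟨?_, ?_⟩
  · rw [hzeq]
    have hderiv : ∀ t : ℝ, 0 ≤ t → HasDerivAt (fun t ↦ Φ (E4.ofTimeSpace t y₀))
        (fderiv ℝ Φ (E4.ofTimeSpace t y₀) (E4.basisVector 0)) t := by
      intro t ht
      exact (hΦd t ht).hasFDerivAt.comp_hasDerivAt t (E4.hasDerivAt_ofTimeSpace_left t y₀)
    have hg : ∀ t ∈ Set.Icc 0 t₀, Φ (E4.ofTimeSpace t y₀) = Φ (E4.ofTimeSpace 0 y₀) := by
      refine constant_of_has_deriv_right_zero
        (fun t ht ↦ (hderiv t ht.1).continuousAt.continuousWithinAt) fun t ht ↦ ?_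
      have := hderiv t ht.1
      rw [hseg t ⟨ht.1, ht.2.le⟩, zero_apply] at this
      exact this.hasDerivWithinAt
    rw [hg t₀ ⟨hz0, le_rfl⟩]
    exact hdata0
  · rw [hzeq]
    exact hseg t₀ ⟨hz0, le_rfl⟩

omit [Kerr.Facts] [Kerr.SliceFacts] in
/-- The spatial norm of a shell point is at least its coordinate radius:
`‖Y_M(r, θ, φ)‖² = r² + M² sin² θ ≥ r²` (trivial for `r < 0`). [folklore] -/
theorem le_spatialNorm_shellPoint (M τ r θ φ : ℝ) :
    r ≤ E4.spatialNorm (shellPoint M τ r θ φ) := by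
  have h : E4.spatialNorm (shellPoint M τ r θ φ) = ‖Kerr.kerrStar M r θ φ‖ := by
    rw [shellPoint, E4.spatialNorm_ofTimeSpace]
  rw [h]
  have hsq := Kerr.norm_sq_kerrStar M r θ φ
  have h0 : 0 ≤ ‖Kerr.kerrStar M r θ φ‖ := norm_nonneg _
  nlinarith [sq_nonneg (M * Real.sin θ)]

/-- **Corollary (no flux through far cylinders).** For the class as in `eq_zero_of_far`, a time
`T ≥ 0` and a coordinate radius `r₂ > max(ρ, 2M) + 1 + T`, the differential of `Φ` vanishes at all
shell points `p(t, r₂, θ, φ)` with `0 ≤ t ≤ T` — the hypothesis `hfar` of the energy identities of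
`ExtremalHorizonTEnergy.lean` / `KerrStarEnergyIdentity.lean`. [cite: BarGinouxPfaffle2007, Ch. 3 Sect. 2 (Thm. 2.9 of the arXiv version)] -/
theorem fderiv_shellPoint_eq_zero_of_far (hM : 0 < M) (hr₀ : r₀ ∈ Set.Ioo 0 M) (hU₀ : IsOpen U₀)
    (hKU : {x : Kerr.region M r₀ | Kerr.rPlus M M ≤ Kerr.radius M (x : E4) ∧ 0 ≤ (x : E4) 0} ⊆ U₀)
    (hΦ : ∀ x ∈ U₀, ContDiffAt ℝ ∞ Φ x)
    (hsol : ∀ x ∈ U₀, (Kerr.smoothMetric M M r₀).toPseudoRiemannianMetric.dalembertian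
      (fun y : Kerr.region M r₀ ↦ Φ y) x = 0)
    {ρ : ℝ} (hloc : ∀ x ∈ U₀, (x : E4) 0 = 0 → ρ < E4.spatialNorm (x : E4) → Φ x = 0 ∧ fderiv ℝ Φ x = 0)
    {T r₂ : ℝ} (hr₂ : max ρ (2 * M) + 1 + T < r₂) {t : ℝ} (ht0 : 0 ≤ t) (htT : t ≤ T) (θ φ : ℝ) :
    Φ (shellPoint M t r₂ θ φ) = 0 ∧ fderiv ℝ Φ (shellPoint M t r₂ θ φ) = 0 := by
  refine eq_zero_of_far hM hr₀ hU₀ hKU hΦ hsol hloc (z := shellPoint M t r₂ θ φ)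
    (by rw [shellPoint_apply_zero]; exact ht0) ?_
  rw [shellPoint_apply_zero]
  exact lt_of_lt_of_le (by linarith) (le_spatialNorm_shellPoint M t r₂ θ φ)

end FiniteSpeed

end Literature.Barriers.FinalStateConjecture.Kerr

end
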